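import Summits.CriticalPhenomena.Ising3DConformalLimit.Theorems.EnergyNotSigmaSquaredGapForcesFarMergingSandwichDefs
import HarnessLib

/-! # Octave counting given the near-pinch floor
(line `one-cluster-depletion-sandwich` of crux `GapForcesFarMerging`, item stmt-CriticalPhenomena-4468;
helper file of stub `stub_octaveCounting`, registered helper `octaveCounting_of_floor`)

`FLOOR → OnePinchDecay → HazardDomination → TailTightness → FarHitIO`, where FLOOR is the near-pinch floor
`∀ R, ∃ δ₀ > 0, ∀ K, R < 2^K → ∀ᶠ n, δ₀ ≤ avoidIn n R (pinch K)` (proved in the sibling file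
`…SandwichNearPinchFloor`, registered helper `nearPinchFloor`; kept as a hypothesis here so that this pure
bookkeeping is independent of it), by contradiction (the bookkeeping of the gen-1 Disproof §7 STEP 1 run
backwards; only "infinitely often" is produced).

Assume `¬FarHitIO`. With `κ, C_d, θ` from `OnePinchDecay` put `ρ = 2^{-κ} < 1`, `λ = (1+ρ)/2 ∈ (ρ,1)`,
`η = (1-λ)/2`; with `M, k₁, C, ε` from `HazardDomination θ` put `c = η/(|C|+1)` (so `Cc ≤ η`). By `¬FarHitIO`,
for each of the finitely many injective shapes `y ∈ (Λ_M)⁴` and all dilations `L ≥ J₀`, eventually in `n`,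
`meet n (L•y) < c` (`Filter.eventually_all_finset`); choose `k₀ ≥ J₀ + k₁` with `ε_k < η` for `k ≥ k₀`. The
NEAR-PINCH FLOOR gives `δ₀ > 0` with
`avoidIn n (2^{k₀}) (pinch K) ≥ δ₀` for `2^K > 2^{k₀}`, eventually in `n`; `TailTightness θ` gives `δ`. Pick
(`∃ᶠ K`) a doubling octave `K > k₀` carrying the decay bound and so large that `C_d (ρ/λ)^K < δδ₀λ³`, then one
box size `n` at which decay, tail, floor, the `K+3-k₀` hazard bounds and all the smallness statements hold.
There the hazards are `≤ Cc + ε_k ≤ 1-λ`, so `avoidIn n (2^k) ≥ λ·avoidIn n (2^{k-1})` for `k₀ < k ≤ K+3`,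
whence `avoid n (pinch K) ≥ δ·avoidIn n (2^{K+3}) ≥ δλ^{K+3-k₀}δ₀ ≥ δδ₀λ³λ^K > C_d ρ^K ≥ avoid n (pinch K)`,
absurd. References: Aizenman–Duminil-Copin 2021, §6.2 (6.11)–(6.13); Lawler 1991, ch. 3–5. -/

noncomputable section

namespace Summit.CriticalPhenomena.Ising3DConformalLimit.EnergyNotSigmaSquaredGapForcesFarMergingSandwich

namespace OctaveCountingProof

open scoped symmDiff ENNReal
open MeasureTheory Filter
open Literature.Probability.LatticeModels Literature.Probability.Percolation
open Summit.CriticalPhenomena.Ising3DConformalLimit.GapForcesFarMergingSandwich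
open Summit.CriticalPhenomena.Ising3DConformalLimit.Theses.EnergyNotSigmaSquared

/-! ### Elementary bookkeeping -/

/-- `avoidIn` is a probability, in particular nonnegative. [folklore] -/
theorem avoidIn_nonneg (n R : ℕ) (y : Fin 4 → Site 3) : 0 ≤ avoidIn n R y := measureReal_nonneg

/-- **Geometric telescoping**: if `λ·a_{k-1} ≤ a_k` for `k₀ < k ≤ N` and `λ ≥ 0`, then
`λ^{N-k₀}·a_{k₀} ≤ a_N`. [folklore] -/
theorem geometric_lower {a : ℕ → ℝ} {lam : ℝ} (hlam : 0 ≤ lam) {k₀ N : ℕ} (hk : k₀ ≤ N)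
    (hstep : ∀ k : ℕ, k₀ < k → k ≤ N → lam * a (k - 1) ≤ a k) :
    lam ^ (N - k₀) * a k₀ ≤ a N := by
  have key : ∀ m : ℕ, k₀ + m ≤ N → lam ^ m * a k₀ ≤ a (k₀ + m) := by
    intro m
    induction m with
    | zero => intro _; simp
    | succ m ih =>
      intro hm
      have h1 := ih (by omega)
      have h2 := hstep (k₀ + (m + 1)) (by omega) hm
      rw [show k₀ + (m + 1) - 1 = k₀ + m by omega] at h2
      calc lam ^ (m + 1) * a k₀ = lam * (lam ^ m * a k₀) := by ring
        _ ≤ lam * a (k₀ + m) := mul_le_mul_of_nonneg_left h1 hlam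
        _ ≤ a (k₀ + (m + 1)) := h2
  have h := key (N - k₀) (by omega)
  rwa [show k₀ + (N - k₀) = N by omega] at h

/-- `(2^K)^{-κ} = (2^{-κ})^K`. [folklore] -/
theorem two_pow_rpow_neg (κ : ℝ) (K : ℕ) : ((2 : ℝ) ^ K) ^ (-κ) = ((2 : ℝ) ^ (-κ)) ^ K := by
  rw [← Real.rpow_natCast_mul two_pos.le K (-κ), mul_comm, Real.rpow_mul_natCast two_pos.le (-κ) K]

/-- The dyadic dilation of `FarHitIO` (`L = 2^j : ℕ`) is the dilation of `HazardDomination` (`(2:ℤ)^j`). [folklore] -/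
theorem dilate_two_pow (j : ℕ) (y : Fin 4 → Site 3) :
    (fun i => (((2 ^ j : ℕ) : ℤ)) • y i) = fun i => ((2 : ℤ) ^ j) • y i := by
  funext i
  rw [Nat.cast_pow, Nat.cast_ofNat]

/-- `¬FarHitIO`, read positively: every injective shape, dilated far enough, has duplicated hitting `< c`
eventually in the box size, for every `c > 0`. [folklore] -/
theorem eventually_meet_lt_of_not_farHitIO (hfar : ¬FarHitIO) {c : ℝ} (hc : 0 < c) (y : Fin 4 → Site 3)
    (hy : Function.Injective y) :
    ∀ᶠ L : ℕ in atTop, ∀ᶠ n : ℕ in atTop, meet n (fun i => (L : ℤ) • y i) < c := by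
  by_contra hcon
  apply hfar
  refine ⟨c, hc, y, hy, fun L₀ => ?_⟩
  rw [Filter.not_eventually] at hcon
  obtain ⟨L, hL, hL₀⟩ := (hcon.and_eventually (eventually_ge_atTop L₀)).exists
  refine ⟨L, hL₀, ?_⟩
  rw [Filter.not_eventually] at hL
  exact hL.mono fun n hn => not_lt.1 hn

/-! ### The counting -/

/-- **Octave counting, given the near-pinch floor**: `OnePinchDecay → HazardDomination → TailTightness → FarHitIO`
assuming the floor `∀ R, ∃ δ₀ > 0, ∀ K, R < 2^K → ∀ᶠ n, δ₀ ≤ avoidIn n R (pinch K)`.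
[cite: AizenmanDuminilCopinAnnals2021, §6.2 (6.11)–(6.13)] -/
theorem farHitIO_of_floor
    (hfloor : ∀ R : ℕ, ∃ δ₀ : ℝ, 0 < δ₀ ∧ ∀ K : ℕ, R < 2 ^ K → ∀ᶠ n : ℕ in atTop, δ₀ ≤ avoidIn n R (pinch K))
    (hdecay : OnePinchDecay) (hhaz : HazardDomination) (htail : TailTightness) : FarHitIO := by
  by_contra hfar
  obtain ⟨κ, Cd, θ, hκ, hθ, hfreq⟩ := hdecay
  obtain ⟨M, k₁, Ch, ε, hε, hhazK⟩ := hhaz θ hθ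
  obtain ⟨δ, hδ, htailK⟩ := htail θ hθ
  -- rates
  set ρ : ℝ := (2 : ℝ) ^ (-κ) with hρ
  have hρpos : 0 < ρ := Real.rpow_pos_of_pos two_pos _
  have hρlt : ρ < 1 := Real.rpow_lt_one_of_one_lt_of_neg one_lt_two (neg_lt_zero.2 hκ)
  set lam : ℝ := (1 + ρ) / 2 with hlam
  have hlam_pos : 0 < lam := by rw [hlam]; linarith
  have hlam_lt : lam < 1 := by rw [hlam]; linarith
  have hρlam : ρ < lam := by rw [hlam]; linarith
  set η : ℝ := (1 - lam) / 2 with hη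
  have hηpos : 0 < η := by rw [hη]; linarith
  set c : ℝ := η / (|Ch| + 1) with hc
  have hcpos : 0 < c := by positivity
  have hCc : Ch * c ≤ η := by
    have h1 : Ch * c ≤ |Ch| * c := mul_le_mul_of_nonneg_right (le_abs_self Ch) hcpos.le
    have h2 : |Ch| * c ≤ η := by
      rw [hc, mul_div_assoc', div_le_iff₀ (by positivity)]
      nlinarith [abs_nonneg Ch]
    exact h1.trans h2
  -- smallness of the fresh hittings beyond a dilation `J₀`, over the finite family of shapes
  have hfam : ∀ᶠ L : ℕ in atTop, ∀ y ∈ Fintype.piFinset (fun _ : Fin 4 => box 3 M), Function.Injective y →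
      ∀ᶠ n : ℕ in atTop, meet n (fun i => (L : ℤ) • y i) < c := by
    refine (Filter.eventually_all_finset _).2 fun y _ => ?_
    by_cases hinj : Function.Injective y
    · exact (eventually_meet_lt_of_not_farHitIO hfar hcpos y hinj).mono fun L hL _ => hL
    · exact Filter.Eventually.of_forall fun L h => absurd h hinj
  obtain ⟨J₀, hJ₀⟩ := Filter.eventually_atTop.1 hfam
  -- smallness of `ε`
  obtain ⟨k₂, hk₂⟩ := Filter.eventually_atTop.1 (hε.eventually_lt_const hηpos)
  -- the near scale `k₀` and its floor
  set k₀ : ℕ := J₀ + k₁ + k₂ + 1 with hk₀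
  obtain ⟨δ₀, hδ₀, hfloorK⟩ := hfloor (2 ^ k₀)
  -- a far doubling octave `K` carrying the decay bound, with `C_d (ρ/λ)^K < δ δ₀ λ³`
  have hKev : ∀ᶠ K : ℕ in atTop, Cd * (ρ / lam) ^ K < δ * δ₀ * lam ^ 3 := by
    have ht : Tendsto (fun K : ℕ => Cd * (ρ / lam) ^ K) atTop (nhds (Cd * 0)) :=
      (tendsto_pow_atTop_nhds_zero_of_lt_one (div_nonneg hρpos.le hlam_pos.le)
        ((div_lt_one hlam_pos).2 hρlam)).const_mul Cd
    rw [mul_zero] at ht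
    exact ht.eventually_lt_const (by positivity)
  obtain ⟨K, ⟨hKdoub, hKdec⟩, hKge, hKlt⟩ :=
    (hfreq.and_eventually ((eventually_ge_atTop (k₀ + 1)).and hKev)).exists
  -- everything, eventually in `n`, at this octave
  have htailK' := htailK K hKdoub
  have hfloorK' := hfloorK K (Nat.pow_lt_pow_right (by norm_num) (by omega))
  have hhazev : ∀ᶠ n : ℕ in atTop, ∀ k ∈ Finset.Ioc k₀ (K + 3), ∀ c' : ℝ,
      (∀ y : Fin 4 → Site 3, Function.Injective y → (∀ i, y i ∈ box 3 M) →
          ∀ j : ℕ, k ≤ j + k₁ → j ≤ k + 2 → meet n (fun i => ((2 : ℤ) ^ j) • y i) ≤ c') →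
        avoidIn n (2 ^ (k - 1)) (pinch K) - avoidIn n (2 ^ k) (pinch K) ≤
          (Ch * c' + ε k) * avoidIn n (2 ^ (k - 1)) (pinch K) :=
    (Filter.eventually_all_finset _).2 fun k hk =>
      hhazK k K (by rw [Finset.mem_Ioc] at hk; omega) (Finset.mem_Ioc.1 hk).2 hKdoub
  have hmeetev : ∀ᶠ n : ℕ in atTop, ∀ j ∈ Finset.Icc J₀ (K + 5),
      ∀ y ∈ Fintype.piFinset (fun _ : Fin 4 => box 3 M), Function.Injective y →
        meet n (fun i => ((2 : ℤ) ^ j) • y i) < c := by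
    refine (Filter.eventually_all_finset _).2 fun j hj => (Filter.eventually_all_finset _).2 fun y hy => ?_
    by_cases hinj : Function.Injective y
    · have hle : J₀ ≤ 2 ^ j := ((Finset.mem_Icc.1 hj).1).trans Nat.lt_two_pow_self.le
      have h := hJ₀ (2 ^ j) hle y hy hinj
      rw [dilate_two_pow] at h
      exact h.mono fun n hn _ => hn
    · exact Filter.Eventually.of_forall fun n h => absurd h hinj
  obtain ⟨n, hn_dec, hn_tail, hn_floor, hn_haz, hn_meet⟩ :=
    (hKdec.and (htailK'.and (hfloorK'.and (hhazev.and hmeetev)))).exists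
  -- the per-octave hazard bounds at this `n`
  have hstep : ∀ k : ℕ, k₀ < k → k ≤ K + 3 →
      lam * avoidIn n (2 ^ (k - 1)) (pinch K) ≤ avoidIn n (2 ^ k) (pinch K) := by
    intro k hk1 hk2
    have hhyp : ∀ y : Fin 4 → Site 3, Function.Injective y → (∀ i, y i ∈ box 3 M) →
        ∀ j : ℕ, k ≤ j + k₁ → j ≤ k + 2 → meet n (fun i => ((2 : ℤ) ^ j) • y i) ≤ c := by
      intro y hy hbox j hj1 hj2
      refine (hn_meet j (Finset.mem_Icc.2 ⟨by omega, by omega⟩) y (Fintype.mem_piFinset.2 hbox) hy).le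
    have hb := hn_haz k (Finset.mem_Ioc.2 ⟨hk1, hk2⟩) c hhyp
    have hεk : ε k < η := hk₂ k (by omega)
    have ha0 := avoidIn_nonneg n (2 ^ (k - 1)) (pinch K)
    have hrate : (Ch * c + ε k) * avoidIn n (2 ^ (k - 1)) (pinch K) ≤ (1 - lam) * avoidIn n (2 ^ (k - 1)) (pinch K) :=
      mul_le_mul_of_nonneg_right (by rw [hη] at hCc hεk; linarith) ha0
    linarith
  have hgeo := geometric_lower (a := fun k => avoidIn n (2 ^ k) (pinch K)) hlam_pos.le
    (show k₀ ≤ K + 3 by omega) hstep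
  -- assemble the contradiction
  have hlow : δ * δ₀ * lam ^ 3 * lam ^ K ≤ avoid n (pinch K) := by
    have h1 : lam ^ (K + 3) ≤ lam ^ (K + 3 - k₀) := pow_le_pow_of_le_one hlam_pos.le hlam_lt.le (by omega)
    have h2 : lam ^ (K + 3) * δ₀ ≤ avoidIn n (2 ^ (K + 3)) (pinch K) :=
      calc lam ^ (K + 3) * δ₀ ≤ lam ^ (K + 3 - k₀) * avoidIn n (2 ^ k₀) (pinch K) :=
            mul_le_mul h1 hn_floor hδ₀.le (pow_nonneg hlam_pos.le _)
        _ ≤ avoidIn n (2 ^ (K + 3)) (pinch K) := hgeo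
    calc δ * δ₀ * lam ^ 3 * lam ^ K = δ * (lam ^ (K + 3) * δ₀) := by ring
      _ ≤ δ * avoidIn n (2 ^ (K + 3)) (pinch K) := mul_le_mul_of_nonneg_left h2 hδ.le
      _ ≤ avoid n (pinch K) := hn_tail
  have hup : avoid n (pinch K) ≤ Cd * (ρ / lam) ^ K * lam ^ K := by
    have h : Cd * (ρ / lam) ^ K * lam ^ K = Cd * ((2 : ℝ) ^ K) ^ (-κ) := by
      rw [two_pow_rpow_neg, ← hρ, div_pow, mul_assoc, div_mul_cancel₀ _ (pow_ne_zero K hlam_pos.ne')]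
    rw [h]; exact hn_dec
  have hKlt' : Cd * (ρ / lam) ^ K * lam ^ K < δ * δ₀ * lam ^ 3 * lam ^ K :=
    mul_lt_mul_of_pos_right hKlt (pow_pos hlam_pos K)
  linarith

end OctaveCountingProof

open Summit.CriticalPhenomena.Ising3DConformalLimit.GapForcesFarMergingSandwich

/-- **Octave counting given the near-pinch floor** (registered helper of `stub_octaveCounting`): the
near-pinch floor, one-pinch decay along doubling octaves, per-octave hazard domination by fresh dilated shapes
and tail tightness force far duplicated hitting of ONE dilated injective lattice shape, infinitely often.
[cite: AizenmanDuminilCopinAnnals2021, §6.2 (6.11)–(6.13)] -/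
theorem octaveCounting_of_floor : (∀ R : ℕ, ∃ δ₀ : ℝ, 0 < δ₀ ∧ ∀ K : ℕ, R < 2 ^ K → ∀ᶠ n : ℕ in Filter.atTop, δ₀ ≤ avoidIn n R (pinch K)) → OnePinchDecay → HazardDomination → TailTightness → FarHitIO :=
  OctaveCountingProof.farHitIO_of_floor

end Summit.CriticalPhenomena.Ising3DConformalLimit.EnergyNotSigmaSquaredGapForcesFarMergingSandwich

end
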